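import Literature.AlgebraicGeometry.ProjectiveSpace.StanleyReisnerHilbertFunction
import HarnessLib

/-!
# Unions and intersections of coordinate subspace arrangements: `I_{Δ₁ ∪ Δ₂} = I_{Δ₁} ∩ I_{Δ₂}`,
# `I_{Δ₁ ∧ Δ₂} = I_{Δ₁} + I_{Δ₂}`, and the Hilbert functions
# (Miller–Sturmfels Thm. 1.7, Def. 1.6; Bruns–Herzog Thm. 5.1.4, 5.1.7)

Topic `Literature/AlgebraicGeometry/ProjectiveSpace`, namespace
`Literature.AlgebraicGeometry.ProjectiveSpace`. Lane `lit-hodgefound`, seat `lit-hodgefound-p32`,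
row gen27-#13. Theorems only (no `def`, no named fact). Companion of `StanleyReisnerHilbertFunction`.

## The sources, as printed, and what is derived

E. Miller, B. Sturmfels, *Combinatorial Commutative Algebra*, Thm. 1.7: "`I_Δ = ⋂_{σ ∈ Δ} 𝔪^{σ̄}`";
Def. 1.6: "`I_Δ = ⟨x^τ | τ ∉ Δ⟩` generated by monomials corresponding to nonfaces `τ` of `Δ`";
Bruns–Herzog Thm. 5.1.4 (the same two descriptions) and Thm. 5.1.7 (the monomials supported on faces
are a `k`-basis of `k[Δ]`). For two families `Δ₁`, `Δ₂` of coordinate subspaces of the same `k^σ` these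
give at once (this file records the one-line consequences, which the sources use without statement):
the faces of `Δ₁ ∪ Δ₂` are the faces of either, so **`I_{Δ₁ ∪ Δ₂} = I_{Δ₁} ∩ I_{Δ₂}`** (Thm. 1.7); the
non-faces of the family of pairwise intersections `Δ₁ ∧ Δ₂ = {F ∩ G}` — whose cone is
`A(Δ₁) ∩ A(Δ₂)` — are the sets that are a non-face of `Δ₁` or of `Δ₂`, so
**`I_{Δ₁ ∧ Δ₂} = I_{Δ₁} + I_{Δ₂}`** (Def. 1.6); and with the lattice identity
`H(I ∩ J) + H(I + J) = H(I) + H(J)` of the tree (`Literature.RingTheory.MvPolynomial.hilbert_inf_add_hilbert_sup`)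
the Hilbert functions satisfy **`H_{Δ₁ ∪ Δ₂} + H_{Δ₁ ∧ Δ₂} = H_{Δ₁} + H_{Δ₂}`** (equivalently:
the face-supported monomials of `Δ₁ ∪ Δ₂` are the union of those of `Δ₁` and `Δ₂`, meeting in those of
`Δ₁ ∧ Δ₂`, Thm. 5.1.7).

* § 1 the cones: `A(Δ₁ ∪ Δ₂) = A(Δ₁) ∪ A(Δ₂)`, `A(Δ₁) ∩ A(Δ₂) = A(Δ₁ ∧ Δ₂)`.
* § 2 the ideals (`k` infinite for the sum).
* § 3 the Hilbert functions, and the example of two coordinate planes of `ℙ³` meeting in a line: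
  `H(n) = 2 binom(n+2, 2) − (n + 1) = (n + 1)²`.

## References

* [MillerSturmfels2005] E. Miller, B. Sturmfels, *Combinatorial Commutative Algebra*, GTM 227,
  Springer 2005, Def. 1.6, Thm. 1.7.
* [BrunsHerzog1998] W. Bruns, J. Herzog, *Cohen–Macaulay Rings*, rev. ed., CUP 1998, Thm. 5.1.4,
  Thm. 5.1.7.
* [Harris1992] J. Harris, *Algebraic Geometry: A First Course*, GTM 133, Springer 1992, Exercise 13.8
  (ii) (two incident lines), for the pattern `H_{X ∪ Y} = H_X + H_Y − H_{X ∩ Y}` of linear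
  configurations.
-/

noncomputable section

open MvPolynomial Module Finset
open Literature.RingTheory.MvPolynomial

universe u

namespace Literature.AlgebraicGeometry.ProjectiveSpace

variable {k : Type u} [Field k] {σ : Type*}

/-! ### § 1 The cones of a union and of the pairwise intersections -/

/-- `A(Δ₁ ∪ Δ₂) = A(Δ₁) ∪ A(Δ₂)`. [cite: MillerSturmfels2005, Remark 1.9 (unions of coordinate
subspaces)] -/
theorem coordArrangement_union (Δ₁ Δ₂ : Set (Finset σ)) :
    {p : σ → k | ∃ F ∈ Δ₁ ∪ Δ₂, ∀ i ∉ F, p i = 0} =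
      {p : σ → k | ∃ F ∈ Δ₁, ∀ i ∉ F, p i = 0} ∪ {p : σ → k | ∃ F ∈ Δ₂, ∀ i ∉ F, p i = 0} := by
  ext p
  simp only [Set.mem_setOf_eq, Set.mem_union, ← exists_or, ← or_and_right]

/-- `A(Δ₁) ∩ A(Δ₂) = A(Δ₁ ∧ Δ₂)` with `Δ₁ ∧ Δ₂ = {F ∩ G | F ∈ Δ₁, G ∈ Δ₂}` (`k^F ∩ k^G = k^{F ∩ G}`).
[cite: MillerSturmfels2005, Remark 1.9 (unions of coordinate subspaces)] -/
theorem coordArrangement_inter [DecidableEq σ] (Δ₁ Δ₂ : Set (Finset σ)) :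
    {p : σ → k | ∃ F ∈ Δ₁, ∀ i ∉ F, p i = 0} ∩ {p : σ → k | ∃ F ∈ Δ₂, ∀ i ∉ F, p i = 0} =
      {p : σ → k | ∃ E ∈ Set.image2 (· ∩ ·) Δ₁ Δ₂, ∀ i ∉ E, p i = 0} := by
  ext p
  simp only [Set.mem_inter_iff, Set.mem_setOf_eq, Set.mem_image2]
  constructor
  · rintro ⟨⟨F, hF, hpF⟩, ⟨G, hG, hpG⟩⟩
    refine ⟨F ∩ G, ⟨F, hF, G, hG, rfl⟩, fun i hi => ?_⟩
    rw [Finset.mem_inter, not_and_or] at hi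
    exact hi.elim (hpF i) (hpG i)
  · rintro ⟨E, ⟨F, hF, G, hG, rfl⟩, hp⟩
    exact ⟨⟨F, hF, fun i hi => hp i fun h => hi (Finset.mem_inter.mp h).1⟩,
      ⟨G, hG, fun i hi => hp i fun h => hi (Finset.mem_inter.mp h).2⟩⟩

/-- The non-faces of `Δ₁ ∧ Δ₂` are the sets that are a non-face of `Δ₁` or a non-face of `Δ₂`.
[cite: MillerSturmfels2005, Def. 1.6] -/
theorem forall_mem_image2_inter_not_subset_iff [DecidableEq σ] (Δ₁ Δ₂ : Set (Finset σ))
    (G : Finset σ) :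
    (∀ E ∈ Set.image2 (· ∩ ·) Δ₁ Δ₂, ¬ G ⊆ E) ↔ (∀ F ∈ Δ₁, ¬ G ⊆ F) ∨ (∀ F ∈ Δ₂, ¬ G ⊆ F) := by
  rw [Set.forall_mem_image2]
  constructor
  · intro h
    by_contra hcon
    rw [not_or] at hcon
    obtain ⟨hn1, hn2⟩ := hcon
    simp only [not_forall, not_not] at hn1 hn2
    obtain ⟨F₁, hF₁, hGF₁⟩ := hn1
    obtain ⟨F₂, hF₂, hGF₂⟩ := hn2
    exact h F₁ hF₁ F₂ hF₂ (Finset.subset_inter hGF₁ hGF₂)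
  · rintro (h | h) F₁ hF₁ F₂ hF₂ hG
    · exact h F₁ hF₁ (hG.trans Finset.inter_subset_left)
    · exact h F₂ hF₂ (hG.trans Finset.inter_subset_right)

/-! ### § 2 The ideals -/

/-- **`I_{Δ₁ ∪ Δ₂} = I_{Δ₁} ∩ I_{Δ₂}`** — the ideal of a union of two coordinate arrangements (any
field; for the Stanley–Reisner ideals an immediate consequence of `I_Δ = ⋂_{σ ∈ Δ} 𝔪^{σ̄}`).
[cite: MillerSturmfels2005, Thm. 1.7] [cite: BrunsHerzog1998, Thm. 5.1.4] -/
theorem projVanishingIdeal_coordArrangement_union (Δ₁ Δ₂ : Set (Finset σ)) :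
    projVanishingIdeal {p : σ → k | ∃ F ∈ Δ₁ ∪ Δ₂, ∀ i ∉ F, p i = 0} =
      projVanishingIdeal {p : σ → k | ∃ F ∈ Δ₁, ∀ i ∉ F, p i = 0} ⊓
        projVanishingIdeal {p : σ → k | ∃ F ∈ Δ₂, ∀ i ∉ F, p i = 0} := by
  rw [coordArrangement_union, projVanishingIdeal_union]

/-- **`I_{Δ₁ ∧ Δ₂} = I_{Δ₁} + I_{Δ₂}`** — the ideal of the intersection `A(Δ₁) ∩ A(Δ₂) = A(Δ₁ ∧ Δ₂)`
of two coordinate arrangements is the SUM of the ideals (`k` infinite; for the Stanley–Reisner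
ideals an immediate consequence of `I_Δ = ⟨x^τ | τ ∉ Δ⟩`: a non-face of `Δ₁ ∧ Δ₂` is a non-face of
`Δ₁` or of `Δ₂`). [cite: MillerSturmfels2005, Def. 1.6] [cite: BrunsHerzog1998, Thm. 5.1.4] -/
theorem projVanishingIdeal_coordArrangement_image2_inter [DecidableEq σ] [Infinite k]
    (Δ₁ Δ₂ : Set (Finset σ)) :
    projVanishingIdeal {p : σ → k | ∃ E ∈ Set.image2 (· ∩ ·) Δ₁ Δ₂, ∀ i ∉ E, p i = 0} =
      projVanishingIdeal {p : σ → k | ∃ F ∈ Δ₁, ∀ i ∉ F, p i = 0} ⊔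
        projVanishingIdeal {p : σ → k | ∃ F ∈ Δ₂, ∀ i ∉ F, p i = 0} := by
  rw [projVanishingIdeal_coordArrangement_eq_span_squarefree,
    projVanishingIdeal_coordArrangement_eq_span_squarefree,
    projVanishingIdeal_coordArrangement_eq_span_squarefree, ← Ideal.span_union, ← Set.image_union]
  congr 1
  refine Set.image_congr' ?_ ▸ congrArg _ (Set.ext fun G => ?_)
  · exact fun _ => rfl
  · simp only [Set.mem_setOf_eq, Set.mem_union]
    exact forall_mem_image2_inter_not_subset_iff Δ₁ Δ₂ G

/-- **`I(A(Δ₁) ∩ A(Δ₂)) = I(A(Δ₁)) + I(A(Δ₂))`** (the same, for the intersection of the cones;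
`k` infinite). [cite: MillerSturmfels2005, Def. 1.6] [cite: BrunsHerzog1998, Thm. 5.1.4] -/
theorem projVanishingIdeal_coordArrangement_inter [DecidableEq σ] [Infinite k]
    (Δ₁ Δ₂ : Set (Finset σ)) :
    projVanishingIdeal ({p : σ → k | ∃ F ∈ Δ₁, ∀ i ∉ F, p i = 0} ∩
        {p : σ → k | ∃ F ∈ Δ₂, ∀ i ∉ F, p i = 0}) =
      projVanishingIdeal {p : σ → k | ∃ F ∈ Δ₁, ∀ i ∉ F, p i = 0} ⊔
        projVanishingIdeal {p : σ → k | ∃ F ∈ Δ₂, ∀ i ∉ F, p i = 0} := by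
  rw [coordArrangement_inter, projVanishingIdeal_coordArrangement_image2_inter]

/-! ### § 3 The Hilbert functions -/

/-- **`H_{Δ₁ ∪ Δ₂}(n) + H_{Δ₁ ∧ Δ₂}(n) = H_{Δ₁}(n) + H_{Δ₂}(n)`**: the Hilbert functions of the face
rings of a union and of the pairwise intersections (`k` infinite, finitely many variables) — from
`I_{Δ₁ ∪ Δ₂} = I_{Δ₁} ∩ I_{Δ₂}`, `I_{Δ₁ ∧ Δ₂} = I_{Δ₁} + I_{Δ₂}` and
`H(I ∩ J) + H(I + J) = H(I) + H(J)`; equivalently the face-supported monomials of `Δ₁ ∪ Δ₂` are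
those of `Δ₁` together with those of `Δ₂`, overlapping in those of `Δ₁ ∧ Δ₂`.
[cite: BrunsHerzog1998, Thm. 5.1.7 (the monomial basis)] [cite: MillerSturmfels2005, Thm. 1.7] -/
theorem hilbert_coordArrangement_union_add_inter [Finite σ] [DecidableEq σ] [Infinite k]
    (Δ₁ Δ₂ : Set (Finset σ)) (n : ℕ) :
    (finrank k (homogeneousSubmodule σ k n) -
        finrank k (idealDegree (projVanishingIdeal
          {p : σ → k | ∃ F ∈ Δ₁ ∪ Δ₂, ∀ i ∉ F, p i = 0}) n)) +
      (finrank k (homogeneousSubmodule σ k n) -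
        finrank k (idealDegree (projVanishingIdeal
          {p : σ → k | ∃ E ∈ Set.image2 (· ∩ ·) Δ₁ Δ₂, ∀ i ∉ E, p i = 0}) n)) =
      (finrank k (homogeneousSubmodule σ k n) -
        finrank k (idealDegree (projVanishingIdeal {p : σ → k | ∃ F ∈ Δ₁, ∀ i ∉ F, p i = 0}) n)) +
      (finrank k (homogeneousSubmodule σ k n) -
        finrank k (idealDegree (projVanishingIdeal {p : σ → k | ∃ F ∈ Δ₂, ∀ i ∉ F, p i = 0}) n)) := by
  letI := MvPolynomial.gradedAlgebra (σ := σ) (R := k)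
  rw [projVanishingIdeal_coordArrangement_union, projVanishingIdeal_coordArrangement_image2_inter]
  exact hilbert_inf_add_hilbert_sup (isHomogeneous_projVanishingIdeal _)
    (isHomogeneous_projVanishingIdeal _) n

/-- **Two coordinate planes of `ℙ³` meeting in a line have `H(n) = (n + 1)²`**
(`= 2 binom(n+2, 2) − (n + 1)`: the planes `x₃ = 0`, `x₀ = 0` of `ℙ³`, meeting in the line
`x₀ = x₃ = 0`; `k` infinite). [cite: BrunsHerzog1998, Thm. 5.1.7] [cite: Harris1992, Exercise 13.8
(ii) (the pattern for two incident lines)] -/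
theorem hilbert_two_coordinate_planes_meeting_in_line [Infinite k] (n : ℕ) :
    finrank k (homogeneousSubmodule (Fin 4) k n) -
        finrank k (idealDegree (projVanishingIdeal
          {p : Fin 4 → k | ∃ F ∈ ({{0, 1, 2}} ∪ {{1, 2, 3}} : Set (Finset (Fin 4))),
            ∀ i ∉ F, p i = 0}) n) = (n + 1) ^ 2 := by
  have h := hilbert_coordArrangement_union_add_inter (k := k)
    ({{0, 1, 2}} : Set (Finset (Fin 4))) ({{1, 2, 3}} : Set (Finset (Fin 4))) n
  have h12 : Set.image2 (· ∩ ·) ({{0, 1, 2}} : Set (Finset (Fin 4)))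
      ({{1, 2, 3}} : Set (Finset (Fin 4))) = {({1, 2} : Finset (Fin 4))} := by
    rw [Set.image2_singleton_left, Set.image_singleton]
    congr 1
  have hF : ∀ F : Finset (Fin 4), finrank k (homogeneousSubmodule (Fin 4) k n) -
      finrank k (idealDegree (projVanishingIdeal
        {p : Fin 4 → k | ∃ F' ∈ ({F} : Set (Finset (Fin 4))), ∀ i ∉ F', p i = 0}) n) =
      (F.card + n - 1).choose n := fun F => by
    have hset : {p : Fin 4 → k | ∃ F' ∈ ({F} : Set (Finset (Fin 4))), ∀ i ∉ F', p i = 0} =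
        {p : Fin 4 → k | ∀ i ∉ F, p i = 0} := by
      ext p
      simp only [Set.mem_setOf_eq, Set.mem_singleton_iff, exists_eq_left]
    rw [hset, hilbert_projVanishingIdeal_coordSubspace]
  rw [h12, hF, hF, hF] at h
  have c3 : (({0, 1, 2} : Finset (Fin 4)).card + n - 1).choose n = (n + 2).choose 2 := by
    rw [show ({0, 1, 2} : Finset (Fin 4)).card = 3 by decide,
      show 3 + n - 1 = n + 2 by omega, Nat.choose_symm_add]
  have c3' : (({1, 2, 3} : Finset (Fin 4)).card + n - 1).choose n = (n + 2).choose 2 := by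
    rw [show ({1, 2, 3} : Finset (Fin 4)).card = 3 by decide,
      show 3 + n - 1 = n + 2 by omega, Nat.choose_symm_add]
  have c2 : (({1, 2} : Finset (Fin 4)).card + n - 1).choose n = n + 1 := by
    rw [show ({1, 2} : Finset (Fin 4)).card = 2 by decide,
      show 2 + n - 1 = n + 1 by omega, Nat.choose_symm_add, Nat.choose_one_right]
  rw [c3, c3', c2] at h
  have hc : (n + 2).choose 2 * 2 = (n + 2) * (n + 1) := by
    have := Nat.choose_two_right (n + 2)
    have h2 : (n + 2) * (n + 1) = (n + 2) * (n + 2 - 1) := by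
      rw [show n + 2 - 1 = n + 1 by omega]
    rw [h2, ← Nat.div_mul_cancel (Nat.even_mul_pred_self (n + 2)).two_dvd, this]
  nlinarith [hc]

end Literature.AlgebraicGeometry.ProjectiveSpace
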